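import Literature.Geometry.Kaehler.ComplexTorusLefschetzGroupDimensionCriterion
import Literature.Geometry.Kaehler.ComplexTorusAbelianSurfaceFirstKindHodgeEqLefschetz
import Literature.Geometry.Kaehler.ComplexTorusAbelianSurfaceQuaternionMultiplicationHodgeLieAlgebraDimension
import Literature.Geometry.Kaehler.ComplexTorusHodgeGeneralEndomorphisms
import HarnessLib

/-!
# Moonen–Zarhin 1999 (2.2), Type I(2): `dim Hg(X) = dim_ℝ 𝔥𝔤_ℝ = dim_ℂ 𝔤 = dim Lf(X) = 6` for an abelian SURFACE with
# REAL MULTIPLICATION (`Hg(X) = Res_{F/ℚ} SL_{2,F}`, `(dim 𝔨, dim 𝔭) = (2, 4)`), and the dictionary for SIMPLE surfaces: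
# `dim Hg(X) ∈ {10, 6, 3, 2}` according as `End⁰(X)` is `ℚ`, a real quadratic field, a quaternion algebra, a CM field

Layer `Literature/Geometry/Kaehler`, namespace `Literature.Geometry.Kaehler.ComplexTorus`; lane `lit-hodgefound`
(Track 2 foundations library), Layer A4; prover seat `lit-hodgefound-p17` (generation 49), self-proposed row g49-#4 —
FREE POINTER 2 of generation 48 («the FKRS dictionary at torus level»), the forward half: the one dimension the tree did
not yet have is `dim 𝔥𝔤_ℝ = 6` for Type I(2).  ENGINE (§1, pure linear algebra): if the elements of a subspace
`𝔊 ⊆ End(V)` preserve two complementary planes `W₁ ⊕ W₂ = V`, act tracelessly on each, and every pair of traceless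
endomorphisms of `W₁`, `W₂` is realised by an element of `𝔊`, then restriction identifies `𝔊` with `𝔰𝔩(W₁) × 𝔰𝔩(W₂)`, so
`dim 𝔊 = 3 + 3 = 6`.  For a Type I(2) surface the three hypotheses are g47-#8 (`𝔤 ⊆ 𝔩𝔣_ℂ ⊆ 𝔰𝔩(V_σ) × 𝔰𝔩(V_τ)`:
`IsRiemannForm.forall_trace_restrict_eq_zero_of_mem_hodgeGroupLieC`, `…toLin'_apply_mem_iInf_eigenspace_algHom_of_mem_hodgeGroupLieC`)
and g47-#9 (`𝔤 ⊇ 𝔰𝔩(V_σ) × 𝔰𝔩(V_τ)`: `IsRiemannForm.exists_mem_hodgeGroupLieC_forall_mulVec_eq_of_trace_eq_zero`), on the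
eigenplanes `V_σ, V_τ` of the real quadratic field (`ComplexTorusAbelianSurfaceRealMultiplicationHodgeLieAlgebra`).

THEOREMS ONLY (no definition, no instance, no notation, no named fact; D-0026, net debt 0); nothing restated — consumed BY
NAME besides the above: g49-#3's criterion `IsRiemannForm.hodgeGroupC_eq_lefschetzIdentityC_iff_finrank_eq` with g47-#10's
`IsRiemannForm.hodgeGroupC_eq_lefschetzIdentityC_of_finrank_eq_two` (`dim 𝔩𝔣 = dim 𝔥𝔤`), the six types
(`ComplexTorusHodgeLieAlgebraAbelianSurfacesSixTypes`), `dim 𝔥𝔤 = 10` for `End⁰(X) = ℚ` (`ComplexTorusAbelianSurfaceHodgeGeneral`)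
and `Hg = Sp ⟹ End⁰ = ℚ` (`ComplexTorusHodgeGeneralEndomorphisms`), `dim 𝔥𝔤 = 3` for Type II(1) (g48-#4), `dim 𝔥𝔤 = 2` for
Type IV(2,1) (g48-#7) with `Hg` commutative ⟹ `End⁰` commutative of dimension `4` (g49-#1), the Albert alternative for
`g ≤ 7` and Shimura's exclusions (`ComplexTorusAlbertClassificationLowDimension`, `ComplexTorusAbelianSurfaceShimura`), and
g48-#2's `End⁰(X) = val(K)` for `[F : K] = 1` (`IsSimple.range_valAlgHom_eq_endAlgRat_of_finrank_eq_one`).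

## Sources, VERBATIM (held copies; `p0NNN Lnn` = chunk file and line of the materialised text)

* B. Moonen, Yu. G. Zarhin, *Hodge classes on abelian varieties of low dimension*, Math. Ann. 315 (1999), held
  `paper:arxiv-math_9901113`: (2.2) `g = 2` (p0005 L53–L78) «There are four cases. Type I(1): `X` is an abelian surface
  with `End⁰(X) = ℚ`. Then `Hg(X) = Sp(V,φ) ≅ Sp_{4,ℚ}`. Type I(2): `End⁰(X) = F` is a real quadratic field. Then there is a
  unique `F`-symplectic form `ψ : V × V → F` such that `φ = trace_{F/ℚ} ψ`. The Hodge group is given by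
  `Hg(X) = Res_{F/ℚ} Sp_F(V,ψ)`. Type II(1): `D = End⁰(X)` is a quaternion algebra over `ℚ`, split at `∞` […] Then `Hg(X)`
  is the algebraic group `U_{D^opp}` […]. Type IV(2,1): `End⁰(X) = F` is a quartic CM-field […]. We have `Hg(X) = U_F`»
  (dimensions `10`, `2·3 = 6`, `3`, `2`); Prop. (2.4) (p0005 L110–L120) «(2) Suppose `X` is of CM-type. Then `Hg(X)` is
  a `g`-dimensional algebraic torus […] (3) Suppose `X` is not of CM-type. Then `Hg(X)` is […] semi-simple».
* F. Fité, K. S. Kedlaya, V. Rotger, A. V. Sutherland, *Sato–Tate distributions and Galois endomorphism modules in genus 2*,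
  Compositio Math. 148 (2012), held `paper:arxiv-1110.6638`, §3.2 Lemma 3.7 («`G⁰` is conjugate to one of `U(1)`, `SU(2)`,
  `U(1) × U(1)`, `U(1) × SU(2)`, `SU(2) × SU(2)`, `USp(4)`») and §4.2 (the absolute types **A**–**F** by `End(A_K̄) ⊗ ℝ`:
  **A** `ℤ` ↔ `USp(4)`, **B** real quadratic ↔ `SU(2) × SU(2)`, **E** quaternion ↔ `SU(2)`, **D** quartic CM ↔ `U(1) × U(1)`).
* J. S. Milne, *Lefschetz classes on abelian varieties*, Duke Math. J. 96 (1999), §2 Summary table (type I: `S(A) = Res Sp`,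
  dimension `f · (g/f)(2g/f + 1) = 2 · 3` for `g = f = 2`).
* J. E. Humphreys, *Introduction to Lie Algebras and Representation Theory* (1972), §1.2 (`dim 𝔰𝔩(ℓ+1, F) = (ℓ+1)² − 1`).
* H. Lange, *Abelian Varieties over the Complex Numbers* (2023), §2.6.1 Proposition (table: types, `e ∣ g`), §5.1.5
  Exercise (2)(b) (endomorphism algebras of simple abelian surfaces), §7.2.4 Exercise (4).

## Contents

* §1 ENGINE **`finrank_eq_six_of_isCompl_of_forall_trace_restrict_eq_zero`** (`𝔊 ≅ 𝔰𝔩(W₁) × 𝔰𝔩(W₂)` by restriction; any field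
  of characteristic `0`).
* §2 TYPE I(2) in the `(K, f)` currency of g47-#9 ∕ #10 (`End⁰(X) = f(K)`, `[K : ℚ] = 2`, `K` totally real):
  **`IsRiemannForm.finrank_hodgeGroupComplexLie_eq_six_of_finrank_eq_two`** (`dim_ℂ 𝔤 = 6`),
  **`IsRiemannForm.finrank_hodgeGroupLie_eq_six_of_finrank_eq_two`**, `IsRiemannForm.zdim_hodgeGroupC_eq_six_of_finrank_eq_two`
  (`dim Hg(X) = 6`), `IsRiemannForm.finrank_hodgeIsotropyLie_eq_two_and_of_finrank_eq_two` (`(dim 𝔨, dim 𝔭) = (2, 4)`),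
  `IsRiemannForm.finrank_lefschetzLie_eq_six_of_finrank_eq_two` ∕ `…lefschetzLieRat…` (`dim Lf(X) = dim_ℚ Lie S(X) = 6`).
* §3 SIMPLE SURFACES: `IsSimple.finrank_hodgeGroupLie_eq_six_of_isAlbertTypeI_of_finrank_centerField_eq_two`, THE DICTIONARY
  **`IsSimple.finrank_hodgeGroupLie_mem_four_of_finrank_eq_two`** (`dim 𝔥𝔤_ℝ ∈ {2, 3, 6, 10}`),
  `IsSimple.finrank_hodgeGroupLie_ne_four_of_finrank_eq_two`, `IsSimple.finrank_hodgeGroupLie_ne_one_of_finrank_eq_two`,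
  `IsRiemannForm.not_isSimple_of_finrank_hodgeGroupLie_eq_four`, `IsRiemannForm.not_isSimple_of_finrank_hodgeGroupLie_eq_one`
  (`dim 𝔥𝔤 ∈ {1, 4}` ⟹ `X` is not simple), and the characterisations **`IsRiemannForm.finrank_hodgeGroupLie_eq_ten_iff_endAlgRat_eq_bot_of_finrank_eq_two`**
  (every surface: `dim = 10 ⟺ End⁰(X) = ℚ`), **`IsSimple.finrank_hodgeGroupLie_eq_two_iff_hodgeGroup_comm_of_finrank_eq_two`**
  (`dim = 2 ⟺` CM type), **`IsSimple.finrank_hodgeGroupLie_eq_six_iff_finrank_endAlgRat_eq_two_of_finrank_eq_two`**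
  (`dim = 6 ⟺ dim_ℚ End⁰(X) = 2`, real multiplication), `IsSimple.finrank_hodgeGroupLie_eq_three_iff_finrank_endAlgRat_eq_four_and_of_finrank_eq_two`
  (`dim = 3 ⟺ End⁰(X)` non-commutative, i.e. quaternion).
-/

noncomputable section

open scoped Matrix
open Module Matrix NormedSpace NumberField
open Literature.Algebra.Lie
open Literature.RingTheory.CentralSimple (IsAlbertTypeI IsAlbertTypeII IsAlbertTypeIII IsAlbertTypeIV)
open Literature.NumberTheory.Automorphic (IsZConnected IsQuaternionAlgebra)

namespace Literature.Geometry.Kaehler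

namespace ComplexTorus

/-! ## §1 Engine: a space of endomorphisms restricting isomorphically onto `𝔰𝔩(W₁) × 𝔰𝔩(W₂)` has dimension `6` -/

section Engine

variable {R V : Type*} [Field R] [CharZero R] [AddCommGroup V] [Module R V]

/-- **`dim 𝔊 = dim 𝔰𝔩(W₁) + dim 𝔰𝔩(W₂) = 6`.**  Let `V = W₁ ⊕ W₂` with `dim W₁ = dim W₂ = 2`, and let `𝔊 ⊆ End(V)` be a subspace
whose elements preserve `W₁` and `W₂` and are traceless on each, such that every pair of traceless endomorphisms of
`W₁`, `W₂` is the pair of restrictions of an element of `𝔊`.  Then `Y ↦ (Y|W₁, Y|W₂)` is a linear isomorphism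
`𝔊 ≅ 𝔰𝔩(W₁) × 𝔰𝔩(W₂)` and `dim 𝔊 = 6` («`Res_{F/ℚ} SL_{2,F}` over `ℂ` is `SL(V_σ) × SL(V_τ)`», `dim 𝔰𝔩₂ = 3`).
[cite: MoonenZarhin1999LowDim, §2 (2.2) `g = 2` («Type I(2) … `Hg(X) = Res_{F/ℚ} Sp_F(V,ψ)`»)] [cite: Humphreys1972, §1.2 (`A_ℓ`)] -/
theorem finrank_eq_six_of_isCompl_of_forall_trace_restrict_eq_zero {W₁ W₂ : Submodule R V} (hc : IsCompl W₁ W₂)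
    (hd₁ : finrank R W₁ = 2) (hd₂ : finrank R W₂ = 2) (𝔊 : Submodule R (Module.End R V))
    (hst₁ : ∀ Y ∈ 𝔊, ∀ w ∈ W₁, Y w ∈ W₁) (hst₂ : ∀ Y ∈ 𝔊, ∀ w ∈ W₂, Y w ∈ W₂)
    (htr₁ : ∀ Y (hY : Y ∈ 𝔊), LinearMap.trace R W₁ (Y.restrict (hst₁ Y hY)) = 0)
    (htr₂ : ∀ Y (hY : Y ∈ 𝔊), LinearMap.trace R W₂ (Y.restrict (hst₂ Y hY)) = 0)
    (hsurj : ∀ Y₁ : Module.End R W₁, LinearMap.trace R W₁ Y₁ = 0 → ∀ Y₂ : Module.End R W₂,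
      LinearMap.trace R W₂ Y₂ = 0 → ∃ Y ∈ 𝔊, (∀ w : W₁, ((Y₁ w : W₁) : V) = Y w) ∧ ∀ w : W₂, ((Y₂ w : W₂) : V) = Y w) :
    finrank R 𝔊 = 6 := by
  classical
  haveI : FiniteDimensional R W₁ := Module.finite_of_finrank_eq_succ hd₁
  haveI : FiniteDimensional R W₂ := Module.finite_of_finrank_eq_succ hd₂
  -- the restriction map `ρ : 𝔊 → End(W₁) × End(W₂)`
  let ρ : 𝔊 →ₗ[R] Module.End R W₁ × Module.End R W₂ :=
    { toFun := fun Y ↦ ((Y : Module.End R V).restrict (hst₁ Y Y.2), (Y : Module.End R V).restrict (hst₂ Y Y.2))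
      map_add' := fun Y Y' ↦ Prod.ext
        (LinearMap.ext fun w ↦ Subtype.ext (by
          simp only [LinearMap.coe_restrict_apply, Submodule.coe_add, LinearMap.add_apply, Prod.fst_add]))
        (LinearMap.ext fun w ↦ Subtype.ext (by
          simp only [LinearMap.coe_restrict_apply, Submodule.coe_add, LinearMap.add_apply, Prod.snd_add]))
      map_smul' := fun c Y ↦ Prod.ext
        (LinearMap.ext fun w ↦ Subtype.ext (by
          simp only [LinearMap.coe_restrict_apply, Submodule.coe_smul, LinearMap.smul_apply, RingHom.id_apply,
            Prod.smul_fst]))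
        (LinearMap.ext fun w ↦ Subtype.ext (by
          simp only [LinearMap.coe_restrict_apply, Submodule.coe_smul, LinearMap.smul_apply, RingHom.id_apply,
            Prod.smul_snd])) }
  have hρ₁ : ∀ (Y : 𝔊) (w : W₁), (((ρ Y).1 w : W₁) : V) = (Y : Module.End R V) w := fun _ _ ↦ rfl
  have hρ₂ : ∀ (Y : 𝔊) (w : W₂), (((ρ Y).2 w : W₂) : V) = (Y : Module.End R V) w := fun _ _ ↦ rfl
  -- `ρ` is injective: `V = W₁ + W₂`
  have hinj : Function.Injective ρ := by
    intro Y Y' h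
    apply Subtype.ext
    refine LinearMap.ext fun v ↦ ?_
    have hv : v ∈ W₁ ⊔ W₂ := by rw [hc.sup_eq_top]; exact Submodule.mem_top
    obtain ⟨w₁, hw₁, w₂, hw₂, rfl⟩ := Submodule.mem_sup.1 hv
    have h1 := congrArg (fun T : Module.End R W₁ × Module.End R W₂ ↦ ((T.1 ⟨w₁, hw₁⟩ : W₁) : V)) h
    have h2 := congrArg (fun T : Module.End R W₁ × Module.End R W₂ ↦ ((T.2 ⟨w₂, hw₂⟩ : W₂) : V)) h
    simp only [hρ₁, hρ₂] at h1 h2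
    rw [map_add, map_add, h1, h2]
  -- the traceless pairs `T = ker τ`, `τ = (tr, tr)`
  let τ : (Module.End R W₁ × Module.End R W₂) →ₗ[R] R × R := (LinearMap.trace R W₁).prodMap (LinearMap.trace R W₂)
  -- `range ρ = ker τ`
  have hrange : LinearMap.range ρ = LinearMap.ker τ := by
    refine le_antisymm ?_ ?_
    · rintro _ ⟨Y, rfl⟩
      rw [LinearMap.mem_ker, LinearMap.prodMap_apply, Prod.mk_eq_zero]
      exact ⟨htr₁ Y Y.2, htr₂ Y Y.2⟩
    · rintro ⟨Y₁, Y₂⟩ hY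
      rw [LinearMap.mem_ker, LinearMap.prodMap_apply, Prod.mk_eq_zero] at hY
      obtain ⟨Y, hY𝔊, h1, h2⟩ := hsurj Y₁ hY.1 Y₂ hY.2
      refine ⟨⟨Y, hY𝔊⟩, Prod.ext (LinearMap.ext fun w ↦ Subtype.ext ?_) (LinearMap.ext fun w ↦ Subtype.ext ?_)⟩
      · rw [hρ₁]; exact (h1 w).symm
      · rw [hρ₂]; exact (h2 w).symm
  -- `τ` is onto, so `dim ker τ = 8 − 2 = 6`
  have hτ : LinearMap.range τ = ⊤ := by
    refine LinearMap.range_eq_top.2 fun c ↦ ⟨((c.1 / 2) • (1 : Module.End R W₁), (c.2 / 2) • (1 : Module.End R W₂)), ?_⟩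
    rw [LinearMap.prodMap_apply, map_smul, map_smul, LinearMap.trace_one, LinearMap.trace_one, hd₁, hd₂]
    refine Prod.ext ?_ ?_
    · simp only [smul_eq_mul, Nat.cast_ofNat]; ring
    · simp only [smul_eq_mul, Nat.cast_ofNat]; ring
  have hker : finrank R (LinearMap.ker τ) = 6 := by
    have hsum := LinearMap.finrank_range_add_finrank_ker τ
    rw [hτ, finrank_top, Module.finrank_prod, Module.finrank_prod, Module.finrank_self, Module.finrank_linearMap,
      Module.finrank_linearMap, hd₁, hd₂] at hsum
    omega
  rw [← LinearMap.finrank_range_of_inj hinj, hrange, hker]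

end Engine

/-! ## §2 Type I(2): `dim_ℂ 𝔤 = dim_ℝ 𝔥𝔤_ℝ = dim Hg(X) = dim Lf(X) = 6`, `(dim 𝔨, dim 𝔭) = (2, 4)` -/

section TypeOneTwo

variable {ι : Type} [Fintype ι] [DecidableEq ι] {E : Type} [NormedAddCommGroup E] [NormedSpace ℂ E]
  [FiniteDimensional ℂ E] {Φ : (ι → ℝ) ≃L[ℝ] E} {η : E [⋀^Fin 2]→L[ℝ] ℝ} {K : Type*} [Field K] [NumberField K]
  [NumberField.IsTotallyReal K]

/-- **MOONEN–ZARHIN (2.2), TYPE I(2): `dim_ℂ 𝔤 = 6`** for a polarised complex abelian surface whose endomorphism algebra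
`End⁰(X) = f(K)` is a real quadratic field: `𝔤 = Lie Hg(X)(ℂ)` restricts isomorphically onto `𝔰𝔩(V_σ) × 𝔰𝔩(V_τ)` on the
two eigenplanes of `K` («`Hg(X) = Res_{F/ℚ} Sp_F(V,ψ)`»; over `ℂ`, `Res_{F/ℚ} SL_{2,F} = SL₂ × SL₂`, of dimension `6`).
[cite: MoonenZarhin1999LowDim, §2 (2.2) `g = 2` («Type I(2) … The Hodge group is given by `Hg(X) = Res_{F/ℚ} Sp_F(V,ψ)`»)]
[cite: FiteEtAl2012, §3.2 Lemma 3.7 and §4.2 (type **B** ↔ `SU(2) × SU(2)`)] [cite: Humphreys1972, §1.2] -/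
theorem IsRiemannForm.finrank_hodgeGroupComplexLie_eq_six_of_finrank_eq_two (hη : IsRiemannForm Φ η)
    (h2 : finrank ℂ E = 2) (hK : finrank ℚ K = 2) (f : K →ₐ[ℚ] Matrix ι ι ℚ) (hfE : f.range = endAlgRat Φ) :
    finrank ℂ (hodgeGroupComplexLie Φ) = 6 := by
  classical
  letI : LieRing (Matrix ι ι ℂ) := LieRing.ofAssociativeRing
  letI : LieAlgebra ℂ (Matrix ι ι ℂ) := LieAlgebra.ofAssociativeAlgebra
  -- two distinct complex embeddings of the quadratic field `K` and the eigenplanes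
  have hcard : Fintype.card (K →+* ℂ) = 2 := by rw [NumberField.Embeddings.card, hK]
  obtain ⟨σ, τ, hστ⟩ : ∃ σ τ : K →+* ℂ, σ ≠ τ := Fintype.exists_pair_of_one_lt_card (by omega)
  have hτσ : τ ≠ σ := fun h ↦ hστ h.symm
  set W₁ : Submodule ℂ (ι → ℂ) := ⨅ y : K, Module.End.eigenspace (Matrix.toLin' ((f y).map (algebraMap ℚ ℂ))) (σ y)
    with hW₁
  set W₂ : Submodule ℂ (ι → ℂ) := ⨅ y : K, Module.End.eigenspace (Matrix.toLin' ((f y).map (algebraMap ℚ ℂ))) (τ y)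
    with hW₂
  have hfE' : ∀ y, f y ∈ endAlgRat Φ := fun y ↦ by rw [← hfE]; exact AlgHom.mem_range_self f y
  have hd₁ : finrank ℂ W₁ = 2 := finrank_iInf_eigenspace_eq_two f Φ h2 hK σ
  have hd₂ : finrank ℂ W₂ = 2 := finrank_iInf_eigenspace_eq_two f Φ h2 hK τ
  have hsup₁₂ : W₁ ⊔ W₂ = ⊤ := sup_iInf_eigenspace_eq_top_of_finrank_eq_two f hK hστ
  have hsup₂₁ : W₂ ⊔ W₁ = ⊤ := sup_iInf_eigenspace_eq_top_of_finrank_eq_two f hK hτσ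
  have hc : IsCompl W₁ W₂ := isCompl_iInf_eigenspace_of_finrank_eq_two f hK hστ
  -- a rational Gram matrix; the Rosati involution is the identity on the totally real `f(K) = End⁰(X)`
  obtain ⟨G, hGη⟩ := hη.exists_ratMatrix_latticeGram
  have hcardι : Fintype.card ι = 4 := by rw [card_eq_two_mul_finrank Φ, h2]
  haveI : Nonempty ι := Fintype.card_pos_iff.1 (by omega)
  have hRos : ∀ A ∈ endAlgRat Φ, rosati G A = A := fun A hA ↦
    rosati_eq_self_of_range_eq Φ f hfE hη.1 hη.2.2 hGη hA
  -- `𝔊 = 𝔤`, transported to `End(ℂ^ι)` along `Matrix.toLin'`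
  set 𝔊 : Submodule ℂ (Module.End ℂ (ι → ℂ)) :=
    (hodgeGroupComplexLie Φ).toSubmodule.comap
      (LinearMap.toMatrix' : Module.End ℂ (ι → ℂ) ≃ₗ[ℂ] Matrix ι ι ℂ).toLinearMap with h𝔊def
  have hmem𝔊 : ∀ Y : Module.End ℂ (ι → ℂ), Y ∈ 𝔊 ↔ LinearMap.toMatrix' Y ∈ hodgeGroupLieC Φ := fun Y ↦ by
    rw [h𝔊def, Submodule.mem_comap, LinearEquiv.coe_coe, LieSubalgebra.mem_toSubmodule,
      mem_hodgeGroupComplexLie_iff_mem_hodgeGroupLieC]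
  have hfin𝔊 : finrank ℂ 𝔊 = finrank ℂ (hodgeGroupComplexLie Φ) :=
    (LinearEquiv.ofSubmodule' (LinearMap.toMatrix' : Module.End ℂ (ι → ℂ) ≃ₗ[ℂ] Matrix ι ι ℂ)
      (hodgeGroupComplexLie Φ).toSubmodule).finrank_eq
  have htoLin : ∀ Y : Module.End ℂ (ι → ℂ), Matrix.toLin' (LinearMap.toMatrix' Y) = Y := fun Y ↦
    Matrix.toLin'_toMatrix' Y
  -- stability and tracelessness on the eigenplanes (g47-#8), surjectivity onto the traceless pairs (g47-#9)
  have hst : ∀ (ν : K →+* ℂ), ∀ Y ∈ 𝔊, ∀ w ∈ (⨅ y : K, Module.End.eigenspace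
      (Matrix.toLin' ((f y).map (algebraMap ℚ ℂ))) (ν y)), Y w ∈ ⨅ y : K, Module.End.eigenspace
      (Matrix.toLin' ((f y).map (algebraMap ℚ ℂ))) (ν y) := fun ν Y hY w hw ↦ by
    have h := hη.toLin'_apply_mem_iInf_eigenspace_algHom_of_mem_hodgeGroupLieC f hfE' hGη ν ((hmem𝔊 Y).1 hY) w hw
    rwa [htoLin] at h
  refine (hfin𝔊.symm.trans (finrank_eq_six_of_isCompl_of_forall_trace_restrict_eq_zero hc hd₁ hd₂ 𝔊 (hst σ) (hst τ)
    (fun Y hY ↦ ?_) (fun Y hY ↦ ?_) fun Y₁ hY₁ Y₂ hY₂ ↦ ?_))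
  · have hZW : ∀ u ∈ W₁, Matrix.toLin' (LinearMap.toMatrix' Y) u ∈ W₁ := fun u hu ↦ by
      rw [htoLin]; exact hst σ Y hY u hu
    have h := hη.forall_trace_restrict_eq_zero_of_mem_hodgeGroupLieC f hfE' hGη hRos hστ hsup₁₂ ((hmem𝔊 Y).1 hY) hZW
    have heq : (Matrix.toLin' (LinearMap.toMatrix' Y)).restrict hZW = Y.restrict (hst σ Y hY) :=
      LinearMap.ext fun w ↦ Subtype.ext (by rw [LinearMap.coe_restrict_apply, LinearMap.coe_restrict_apply, htoLin])
    rwa [heq] at h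
  · have hZW : ∀ u ∈ W₂, Matrix.toLin' (LinearMap.toMatrix' Y) u ∈ W₂ := fun u hu ↦ by
      rw [htoLin]; exact hst τ Y hY u hu
    have h := hη.forall_trace_restrict_eq_zero_of_mem_hodgeGroupLieC f hfE' hGη hRos hτσ hsup₂₁ ((hmem𝔊 Y).1 hY) hZW
    have heq : (Matrix.toLin' (LinearMap.toMatrix' Y)).restrict hZW = Y.restrict (hst τ Y hY) :=
      LinearMap.ext fun w ↦ Subtype.ext (by rw [LinearMap.coe_restrict_apply, LinearMap.coe_restrict_apply, htoLin])
    rwa [heq] at h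
  · obtain ⟨Z, hZ, h₁, h₂⟩ := hη.exists_mem_hodgeGroupLieC_forall_mulVec_eq_of_trace_eq_zero h2 hK f hfE hστ hW₁ hW₂
      Y₁ hY₁ Y₂ hY₂
    refine ⟨Matrix.toLin' Z, ?_, fun w ↦ ?_, fun w ↦ ?_⟩
    · rw [hmem𝔊, LinearMap.toMatrix'_toLin']; exact hZ
    · rw [Matrix.toLin'_apply]; exact h₁ w
    · rw [Matrix.toLin'_apply]; exact h₂ w

/-- **Type I(2): `dim_ℝ 𝔥𝔤_ℝ = 6`** (`𝔥𝔤_ℝ ≅ 𝔰𝔩₂(ℝ) ⊕ 𝔰𝔩₂(ℝ)`, the Lie algebra of `Res_{F/ℚ} SL_{2,F}(ℝ) = SL₂(ℝ)²`).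
[cite: MoonenZarhin1999LowDim, §2 (2.2) `g = 2` («Type I(2)»)] [cite: FiteEtAl2012, §3.2 Lemma 3.7 (`SU(2) × SU(2)`)] -/
theorem IsRiemannForm.finrank_hodgeGroupLie_eq_six_of_finrank_eq_two (hη : IsRiemannForm Φ η)
    (h2 : finrank ℂ E = 2) (hK : finrank ℚ K = 2) (f : K →ₐ[ℚ] Matrix ι ι ℚ) (hfE : f.range = endAlgRat Φ) :
    finrank ℝ (hodgeGroupLie Φ) = 6 := by
  rw [← finrank_hodgeGroupComplexLie_eq_finrank_hodgeGroupLie Φ]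
  exact hη.finrank_hodgeGroupComplexLie_eq_six_of_finrank_eq_two h2 hK f hfE

/-- **Type I(2): `dim Hg(X) = 6`** (the trunk's dimension of the connected algebraic group `Hg(X)(ℂ) ≤ GL(V_ℂ)`).
[cite: MoonenZarhin1999LowDim, §2 (2.2) `g = 2` («Type I(2) … `Hg(X) = Res_{F/ℚ} Sp_F(V,ψ)`»)] [cite: GoodmanWallachGTM255, §1.4.4 Thm. 1.4.10] -/
theorem IsRiemannForm.zdim_hodgeGroupC_eq_six_of_finrank_eq_two (hη : IsRiemannForm Φ η)
    (h2 : finrank ℂ E = 2) (hK : finrank ℚ K = 2) (f : K →ₐ[ℚ] Matrix ι ι ℚ) (hfE : f.range = endAlgRat Φ) :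
    (isZConnected_map_toGL_hodgeGroupC Φ).zdim = 6 :=
  (zdim_hodgeGroupC_eq_iff_finrank_hodgeGroupLie_eq Φ).2 (hη.finrank_hodgeGroupLie_eq_six_of_finrank_eq_two h2 hK f hfE)

/-- **Type I(2): `(dim 𝔨, dim 𝔭) = (2, 4)`** (`𝔨 ≅ 𝔲(1)²`, the compact form `SU(2) × SU(2)` of Sato–Tate type **B**).
[cite: FiteEtAl2012, §3.2 Lemma 3.7 and §4.2 (type **B**: real multiplication ↔ `SU(2) × SU(2)`)] [cite: MoonenZarhin1999LowDim, §2 (2.2) `g = 2` («Type I(2)»)] -/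
theorem IsRiemannForm.finrank_hodgeIsotropyLie_eq_two_and_of_finrank_eq_two (hη : IsRiemannForm Φ η)
    (h2 : finrank ℂ E = 2) (hK : finrank ℚ K = 2) (f : K →ₐ[ℚ] Matrix ι ι ℚ) (hfE : f.range = endAlgRat Φ) :
    finrank ℝ (hodgeIsotropyLie Φ) = 2 ∧ finrank ℝ (hodgeCartanP Φ) = 4 :=
  (hη.finrank_hodgeGroupLie_eq_six_iff_of_finrank_eq_two h2).1 (hη.finrank_hodgeGroupLie_eq_six_of_finrank_eq_two h2 hK f hfE)

/-- **Type I(2): `dim_ℝ 𝔩𝔣 = dim Lf(X) = 6`** (`Lf(X) = S(X) = Res_{F/ℚ} Sp_F(V,ψ)`, Milne's type I row; equal to `dim Hg(X)`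
since `Hg(X) = Lf(X)`, g47-#10). [cite: Milne1999LefschetzClasses, §2 Summary table (type I: `Res Sp`, dimension)]
[cite: MoonenZarhin1999LowDim, §2 (2.2) `g = 2` («Type I(2)»)] -/
theorem IsRiemannForm.finrank_lefschetzLie_eq_six_of_finrank_eq_two (hη : IsRiemannForm Φ η)
    (h2 : finrank ℂ E = 2) (hK : finrank ℚ K = 2) (f : K →ₐ[ℚ] Matrix ι ι ℚ) (hfE : f.range = endAlgRat Φ)
    {G : Matrix ι ι ℚ} (hGη : G.map (Rat.cast : ℚ → ℝ) = latticeGram Φ η) : finrank ℝ (lefschetzLie Φ G) = 6 := by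
  rw [← (hη.hodgeGroupC_eq_lefschetzIdentityC_iff_finrank_eq hGη).1
    (hη.hodgeGroupC_eq_lefschetzIdentityC_of_finrank_eq_two h2 hK f hfE hGη)]
  exact hη.finrank_hodgeGroupLie_eq_six_of_finrank_eq_two h2 hK f hfE

/-- **Type I(2): `dim_ℚ Lie S(X) = 6`** (`Lie S(X) = 𝔰𝔭_F(V, ψ) = 𝔰𝔩_{2,F}`, `dim_ℚ = 2 · 3`). [cite: Milne1999LefschetzClasses, §1 (p. 644) and §2 Summary table (type I)]
[cite: MoonenZarhin1999LowDim, §2 (2.2) `g = 2` («Type I(2)»)] -/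
theorem IsRiemannForm.finrank_lefschetzLieRat_eq_six_of_finrank_eq_two (hη : IsRiemannForm Φ η)
    (h2 : finrank ℂ E = 2) (hK : finrank ℚ K = 2) (f : K →ₐ[ℚ] Matrix ι ι ℚ) (hfE : f.range = endAlgRat Φ)
    {G : Matrix ι ι ℚ} (hGη : G.map (Rat.cast : ℚ → ℝ) = latticeGram Φ η) : finrank ℚ (lefschetzLieRat Φ G) = 6 := by
  rw [finrank_lefschetzLieRat_eq_finrank_lefschetzLie]
  exact hη.finrank_lefschetzLie_eq_six_of_finrank_eq_two h2 hK f hfE hGη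

end TypeOneTwo

/-! ## §3 Simple surfaces: `dim 𝔥𝔤_ℝ ∈ {2, 3, 6, 10}` and the dictionary with `End⁰(X)` -/

section Simple

variable {κ : Type} [Fintype κ] [DecidableEq κ] [Nonempty κ] {E : Type} [NormedAddCommGroup E] [NormedSpace ℂ E]
  [FiniteDimensional ℂ E] {Ψ : (κ → ℝ) ≃L[ℝ] E} {η : E [⋀^Fin 2]→L[ℝ] ℝ} {G : Matrix κ κ ℚ}

omit [FiniteDimensional ℂ E] in
/-- `ℚ ⊆ K ⊆ End_ℚ(X)` is a scalar tower. [folklore] -/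
private theorem isScalarTower_rat₄₉d (hX : IsSimple Ψ) : IsScalarTower ℚ (centerField Ψ hX) (endAlgRat Ψ) :=
  IsScalarTower.of_algebraMap_smul fun q x ↦ by
    rw [Algebra.smul_def, Algebra.algebraMap_eq_smul_one q,
      map_rat_smul (algebraMap (centerField Ψ hX) (endAlgRat Ψ)) q 1, map_one, smul_mul_assoc, one_mul]

/-- **Type I with `e = [K : ℚ] = 2` (REAL MULTIPLICATION): `dim_ℝ 𝔥𝔤_ℝ = 6`** for a simple polarised abelian surface whose
Rosati pair is of Albert type I over a quadratic centre (`End⁰(X) = val(K)` a real quadratic field, `[F : K] = 1`).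
[cite: MoonenZarhin1999LowDim, §2 (2.2) `g = 2` («Type I(2)»)] [cite: Lange2023AbelianVarietiesComplex, §2.6.1 Proposition, table (type I, `d = 1`) and §5.1.5 Exercise (2)(b)] -/
theorem IsSimple.finrank_hodgeGroupLie_eq_six_of_isAlbertTypeI_of_finrank_centerField_eq_two (hX : IsSimple Ψ)
    (hη : IsRiemannForm Ψ η) (hG : G.map (Rat.cast : ℚ → ℝ) = latticeGram Ψ η)
    (h : IsAlbertTypeI (centerField Ψ hX) (endAlgRat Ψ) (rosatiEnd Ψ hη.1 hη.2.2 hG))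
    (he : finrank ℚ (centerField Ψ hX) = 2) (h2 : finrank ℂ E = 2) : finrank ℝ (hodgeGroupLie Ψ) = 6 := by
  haveI : IsTotallyReal (centerField Ψ hX) := h.isTotallyReal
  exact hη.finrank_hodgeGroupLie_eq_six_of_finrank_eq_two h2 he (centerField.valAlgHom Ψ hX)
    (hX.range_valAlgHom_eq_endAlgRat_of_finrank_eq_one h.finrank_eq_one)

/-- **THE DICTIONARY FOR SIMPLE ABELIAN SURFACES: `dim_ℝ 𝔥𝔤_ℝ ∈ {2, 3, 6, 10}`** — Type I(1) (`End⁰(X) = ℚ`): `10`; Type I(2)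
(real quadratic field): `6`; Type II(1) (indefinite quaternion algebra): `3`; Type IV(2,1) (quartic CM field): `2`; type III
does not occur.  (Sato–Tate types **A**, **B**, **E**, **D**: `USp(4)`, `SU(2) × SU(2)`, `SU(2)`, `U(1) × U(1)`.)
[cite: MoonenZarhin1999LowDim, §2 (2.2) `g = 2` (the four cases) and Prop. (2.4)] [cite: FiteEtAl2012, §3.2 Lemma 3.7 and §4.2]
[cite: Lange2023AbelianVarietiesComplex, §5.1.5 Exercise (2)(b)] -/
theorem IsSimple.finrank_hodgeGroupLie_mem_four_of_finrank_eq_two (hX : IsSimple Ψ) (hη : IsRiemannForm Ψ η)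
    (h2 : finrank ℂ E = 2) : finrank ℝ (hodgeGroupLie Ψ) ∈ ({2, 3, 6, 10} : Finset ℕ) := by
  obtain ⟨G, hG⟩ := hη.exists_ratMatrix_latticeGram
  simp only [Finset.mem_insert, Finset.mem_singleton]
  rcases hX.isAlbertType_of_finrank_le_seven hη hG (by omega) with hI | hII | hIII | hIV
  · haveI : IsTotallyReal (centerField Ψ hX) := hI.isTotallyReal
    have hdvd : finrank ℚ (centerField Ψ hX) ∣ finrank ℂ E := hX.finrank_centerField_dvd_of_isTotallyReal
    rw [h2] at hdvd
    have hpos : 0 < finrank ℚ (centerField Ψ hX) := finrank_pos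
    have hle : finrank ℚ (centerField Ψ hX) ≤ 2 := Nat.le_of_dvd two_pos hdvd
    rcases (show finrank ℚ (centerField Ψ hX) = 1 ∨ finrank ℚ (centerField Ψ hX) = 2 by omega) with he | he
    · exact Or.inr (Or.inr (Or.inr (hη.finrank_hodgeGroupLie_eq_ten_of_finrank_eq_two_of_endAlgRat_eq_bot h2
        (hX.endAlgRat_eq_bot_of_finrank_eq_one_of_finrank_centerField_eq_one hI.finrank_eq_one he))))
    · exact Or.inr (Or.inr (Or.inl
        (hX.finrank_hodgeGroupLie_eq_six_of_isAlbertTypeI_of_finrank_centerField_eq_two hη hG hI he h2)))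
  · exact Or.inr (Or.inl (hX.finrank_hodgeGroupLie_eq_three_of_isAlbertTypeII_of_finrank_eq_two hη hG hII h2))
  · exact absurd hIII (hX.not_isAlbertTypeIII_of_finrank_eq_two hη hG h2)
  · exact Or.inl (hX.finrank_hodgeGroupLie_eq_two_of_isAlbertTypeIV_of_finrank_eq_two hη hG hIV h2)

/-- **`dim_ℝ 𝔥𝔤_ℝ ≠ 4` for a SIMPLE abelian surface** (`𝔲(1) ⊕ 𝔰𝔩₂(ℝ)`, Sato–Tate type **C** `U(1) × SU(2)`, only occurs for
`E × E'` with exactly one CM factor). [cite: FiteEtAl2012, §4.2 (type **C**) and §3.2 Lemma 3.7] [cite: MoonenZarhin1999LowDim, §2 Prop. (2.4) (3) («not of CM-type ⟹ `Hg(X)` semi-simple»)] -/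
theorem IsSimple.finrank_hodgeGroupLie_ne_four_of_finrank_eq_two (hX : IsSimple Ψ) (hη : IsRiemannForm Ψ η)
    (h2 : finrank ℂ E = 2) : finrank ℝ (hodgeGroupLie Ψ) ≠ 4 := by
  have h := hX.finrank_hodgeGroupLie_mem_four_of_finrank_eq_two hη h2
  simp only [Finset.mem_insert, Finset.mem_singleton] at h
  omega

/-- **`dim_ℝ 𝔥𝔤_ℝ ≠ 1` for a SIMPLE abelian surface** (`𝔲(1)`, Sato–Tate type **F**, only occurs for `E × E'` with isogenous
CM curves; for simple `X` of CM type `Hg(X)` is a `2`-dimensional torus). [cite: MoonenZarhin1999LowDim, §2 Prop. (2.4) (2)] [cite: FiteEtAl2012, §4.2 (type **F**) and §3.2 Lemma 3.7] -/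
theorem IsSimple.finrank_hodgeGroupLie_ne_one_of_finrank_eq_two (hX : IsSimple Ψ) (hη : IsRiemannForm Ψ η)
    (h2 : finrank ℂ E = 2) : finrank ℝ (hodgeGroupLie Ψ) ≠ 1 := by
  have h := hX.finrank_hodgeGroupLie_mem_four_of_finrank_eq_two hη h2
  simp only [Finset.mem_insert, Finset.mem_singleton] at h
  omega

/-- **An abelian surface with `dim_ℝ 𝔥𝔤_ℝ = 4` is NOT simple** (it is isogenous to `E × E'` with exactly one CM factor).
[cite: FiteEtAl2012, §4.2 (type **C** ↔ `U(1) × SU(2)`)] [cite: MoonenZarhin1999LowDim, §2 Prop. (2.4) and §3] -/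
theorem IsRiemannForm.not_isSimple_of_finrank_hodgeGroupLie_eq_four (hη : IsRiemannForm Ψ η) (h2 : finrank ℂ E = 2)
    (h4 : finrank ℝ (hodgeGroupLie Ψ) = 4) : ¬ IsSimple Ψ := fun hX ↦
  hX.finrank_hodgeGroupLie_ne_four_of_finrank_eq_two hη h2 h4

/-- **An abelian surface with `dim_ℝ 𝔥𝔤_ℝ = 1` is NOT simple** (it is isogenous to the square of a CM elliptic curve).
[cite: FiteEtAl2012, §4.2 (type **F** ↔ `U(1)`)] [cite: MoonenZarhin1999LowDim, §2 Prop. (2.4) (2)] -/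
theorem IsRiemannForm.not_isSimple_of_finrank_hodgeGroupLie_eq_one (hη : IsRiemannForm Ψ η) (h2 : finrank ℂ E = 2)
    (h1 : finrank ℝ (hodgeGroupLie Ψ) = 1) : ¬ IsSimple Ψ := fun hX ↦
  hX.finrank_hodgeGroupLie_ne_one_of_finrank_eq_two hη h2 h1

omit [Nonempty κ] in
/-- **EVERY abelian surface: `dim_ℝ 𝔥𝔤_ℝ = 10 ⟺ End⁰(X) = ℚ`** (`Hg(X) = Sp(V, E)` iff the only endomorphisms are the
integers). [cite: MoonenZarhin1999LowDim, §2 (2.2) `g = 2` («Type I(1): … `End⁰(X) = ℚ`. Then `Hg(X) = Sp(V,φ) ≅ Sp_{4,ℚ}`»)]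
[cite: FiteEtAl2012, §4.2 (type **A** ↔ `USp(4)`)] [cite: Lange2023AbelianVarietiesComplex, §7.2.4 Exercise (3) (`End_ℚ(X) = End_{Hg(X)}(H₁(X,ℚ))`)] -/
theorem IsRiemannForm.finrank_hodgeGroupLie_eq_ten_iff_endAlgRat_eq_bot_of_finrank_eq_two (hη : IsRiemannForm Ψ η)
    (h2 : finrank ℂ E = 2) : finrank ℝ (hodgeGroupLie Ψ) = 10 ↔ endAlgRat Ψ = ⊥ :=
  ⟨fun h ↦ hη.endAlgRat_eq_bot_of_hodgeGroup_eq_spGroup ((hη.finrank_hodgeGroupLie_eq_ten_iff_of_finrank_eq_two h2).1 h),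
    hη.finrank_hodgeGroupLie_eq_ten_of_finrank_eq_two_of_endAlgRat_eq_bot h2⟩

/-- **SIMPLE surfaces: `dim_ℝ 𝔥𝔤_ℝ = 2 ⟺ X` is of CM TYPE** (`Hg(X)` commutative; then `End⁰(X)` is a quartic CM field and
`Hg(X) = U_F`). [cite: MoonenZarhin1999LowDim, §2 Prop. (2.4) (2) («Suppose `X` is of CM-type. Then `Hg(X)` is a `g`-dimensional algebraic torus») and (2.2) («Type IV(2,1)»)]
[cite: FiteEtAl2012, §4.2 (type **D** ↔ `U(1) × U(1)`)] [cite: Lange2023AbelianVarietiesComplex, §7.2.3 Prop. 7.2.6] -/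
theorem IsSimple.finrank_hodgeGroupLie_eq_two_iff_hodgeGroup_comm_of_finrank_eq_two (hX : IsSimple Ψ)
    (hη : IsRiemannForm Ψ η) (h2 : finrank ℂ E = 2) :
    finrank ℝ (hodgeGroupLie Ψ) = 2 ↔ ∀ M ∈ hodgeGroup Ψ, ∀ N ∈ hodgeGroup Ψ, M * N = N * M := by
  refine ⟨fun h ↦ IsAbelianVariety.hodgeGroup_comm_of_finrank_hodgeGroupLie_le_two ⟨η, hη⟩ h.le, fun hc ↦ ?_⟩
  obtain ⟨hcomm, h4⟩ := hX.endAlgRat_comm_and_finrank_eq_four_of_hodgeGroup_comm_of_finrank_eq_two hη h2 hc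
  exact hX.finrank_hodgeGroupLie_eq_two_of_endAlgRat_comm_of_finrank_eq_two hη h2 hcomm h4

/-- **SIMPLE surfaces: `dim_ℝ 𝔥𝔤_ℝ = 6 ⟺ dim_ℚ End⁰(X) = 2`** (REAL MULTIPLICATION by a quadratic field — an imaginary
quadratic `End⁰(X)` does not occur for a simple surface, Shimura). [cite: MoonenZarhin1999LowDim, §2 (2.2) `g = 2` («Type I(2): `End⁰(X) = F` is a real quadratic field»)]
[cite: FiteEtAl2012, §4.2 (type **B** ↔ `SU(2) × SU(2)`)] [cite: HulekLaface2019PicardNumbersAV, §5.1 Prop. 5.1] -/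
theorem IsSimple.finrank_hodgeGroupLie_eq_six_iff_finrank_endAlgRat_eq_two_of_finrank_eq_two (hX : IsSimple Ψ)
    (hη : IsRiemannForm Ψ η) (h2 : finrank ℂ E = 2) :
    finrank ℝ (hodgeGroupLie Ψ) = 6 ↔ finrank ℚ (endAlgRat Ψ) = 2 := by
  haveI := isScalarTower_rat₄₉d hX
  haveI : Nontrivial (endAlgRat Ψ) := ⟨⟨0, 1, fun h01 ↦ zero_ne_one (congrArg Subtype.val h01)⟩⟩
  obtain ⟨G, hG⟩ := hη.exists_ratMatrix_latticeGram
  have hdim : finrank ℚ (endAlgRat Ψ) = finrank ℚ (centerField Ψ hX) * finrank (centerField Ψ hX) (endAlgRat Ψ) :=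
    (Module.finrank_mul_finrank ℚ (centerField Ψ hX) (endAlgRat Ψ)).symm
  rcases hX.isAlbertType_of_finrank_le_seven hη hG (by omega) with hI | hII | hIII | hIV
  · -- type I: `dim End⁰ = e ∈ {1, 2}`, `dim 𝔥𝔤 = 10, 6`
    haveI : IsTotallyReal (centerField Ψ hX) := hI.isTotallyReal
    have hdvd : finrank ℚ (centerField Ψ hX) ∣ finrank ℂ E := hX.finrank_centerField_dvd_of_isTotallyReal
    rw [h2] at hdvd
    have hpos : 0 < finrank ℚ (centerField Ψ hX) := finrank_pos
    have hle : finrank ℚ (centerField Ψ hX) ≤ 2 := Nat.le_of_dvd two_pos hdvd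
    rw [hI.finrank_eq_one, mul_one] at hdim
    rcases (show finrank ℚ (centerField Ψ hX) = 1 ∨ finrank ℚ (centerField Ψ hX) = 2 by omega) with he | he
    · have h10 := hη.finrank_hodgeGroupLie_eq_ten_of_finrank_eq_two_of_endAlgRat_eq_bot h2
        (hX.endAlgRat_eq_bot_of_finrank_eq_one_of_finrank_centerField_eq_one hI.finrank_eq_one he)
      rw [h10, hdim, he]; decide
    · have h6 := hX.finrank_hodgeGroupLie_eq_six_of_isAlbertTypeI_of_finrank_centerField_eq_two hη hG hI he h2
      rw [h6, hdim, he]; decide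
  · -- type II: `dim 𝔥𝔤 = 3`, `dim End⁰ = 4e ≥ 4`
    haveI := hII.isQuaternionAlgebra
    have h3 := hX.finrank_hodgeGroupLie_eq_three_of_isAlbertTypeII_of_finrank_eq_two hη hG hII h2
    rw [IsQuaternionAlgebra.finrank_eq_four (K := centerField Ψ hX) (D := endAlgRat Ψ)] at hdim
    have hpos : 0 < finrank ℚ (centerField Ψ hX) := finrank_pos
    rw [h3, hdim]; omega
  · exact absurd hIII (hX.not_isAlbertTypeIII_of_finrank_eq_two hη hG h2)
  · -- type IV: `dim 𝔥𝔤 = 2`, `[K : ℚ] = 4`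
    haveI := hIV.isCMField
    have h2' := hX.finrank_hodgeGroupLie_eq_two_of_isAlbertTypeIV_of_finrank_eq_two hη hG hIV h2
    obtain ⟨hK4, hF1⟩ := hX.finrank_centerField_eq_four_of_isCMField_of_finrank_eq_two hη h2
    rw [hK4, hF1] at hdim
    rw [h2', hdim]; decide

/-- **SIMPLE surfaces: `dim_ℝ 𝔥𝔤_ℝ = 3 ⟺ End⁰(X)` is a NON-COMMUTATIVE algebra of dimension `4`** (QUATERNION MULTIPLICATION:
`End⁰(X)` an indefinite quaternion algebra over `ℚ`). [cite: MoonenZarhin1999LowDim, §2 (2.2) `g = 2` («Type II(1): `D = End⁰(X)` is a quaternion algebra over `ℚ`, split at `∞` … `Hg(X)` is the algebraic group `U_{D^opp}`»)]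
[cite: FiteEtAl2012, §4.2 (type **E** ↔ `SU(2)`)] [cite: Lange2023AbelianVarietiesComplex, §5.1.5 Exercise (2)(b)] -/
theorem IsSimple.finrank_hodgeGroupLie_eq_three_iff_finrank_endAlgRat_eq_four_and_of_finrank_eq_two (hX : IsSimple Ψ)
    (hη : IsRiemannForm Ψ η) (h2 : finrank ℂ E = 2) :
    finrank ℝ (hodgeGroupLie Ψ) = 3 ↔
      finrank ℚ (endAlgRat Ψ) = 4 ∧ ¬ ∀ a ∈ endAlgRat Ψ, ∀ b ∈ endAlgRat Ψ, a * b = b * a := by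
  haveI := isScalarTower_rat₄₉d hX
  haveI : Nontrivial (endAlgRat Ψ) := ⟨⟨0, 1, fun h01 ↦ zero_ne_one (congrArg Subtype.val h01)⟩⟩
  obtain ⟨G, hG⟩ := hη.exists_ratMatrix_latticeGram
  have hdim : finrank ℚ (endAlgRat Ψ) = finrank ℚ (centerField Ψ hX) * finrank (centerField Ψ hX) (endAlgRat Ψ) :=
    (Module.finrank_mul_finrank ℚ (centerField Ψ hX) (endAlgRat Ψ)).symm
  constructor
  · intro h3
    -- `dim End⁰ = 4`: by the dictionary the type is II (`dim 𝔥𝔤 = 3` excludes `2, 6, 10`)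
    rcases hX.isAlbertType_of_finrank_le_seven hη hG (by omega) with hI | hII | hIII | hIV
    · exfalso
      haveI : IsTotallyReal (centerField Ψ hX) := hI.isTotallyReal
      have hdvd : finrank ℚ (centerField Ψ hX) ∣ finrank ℂ E := hX.finrank_centerField_dvd_of_isTotallyReal
      rw [h2] at hdvd
      have hpos : 0 < finrank ℚ (centerField Ψ hX) := finrank_pos
      have hle : finrank ℚ (centerField Ψ hX) ≤ 2 := Nat.le_of_dvd two_pos hdvd
      rcases (show finrank ℚ (centerField Ψ hX) = 1 ∨ finrank ℚ (centerField Ψ hX) = 2 by omega) with he | he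
      · have h10 := hη.finrank_hodgeGroupLie_eq_ten_of_finrank_eq_two_of_endAlgRat_eq_bot h2
          (hX.endAlgRat_eq_bot_of_finrank_eq_one_of_finrank_centerField_eq_one hI.finrank_eq_one he)
        omega
      · have h6 := hX.finrank_hodgeGroupLie_eq_six_of_isAlbertTypeI_of_finrank_centerField_eq_two hη hG hI he h2
        omega
    · haveI := hII.isQuaternionAlgebra
      rw [IsQuaternionAlgebra.finrank_eq_four (K := centerField Ψ hX) (D := endAlgRat Ψ)] at hdim
      have he : finrank ℚ (centerField Ψ hX) = 1 :=
        hX.finrank_centerField_eq_one_of_isAlbertTypeII_of_finrank_eq_two hη hG hII h2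
      rw [he, one_mul] at hdim
      refine ⟨hdim, fun hcomm ↦ ?_⟩
      -- a commutative `End⁰` of dimension `4` has `dim 𝔥𝔤 = 2`
      have := hX.finrank_hodgeGroupLie_eq_two_of_endAlgRat_comm_of_finrank_eq_two hη h2 hcomm hdim
      omega
    · exact absurd hIII (hX.not_isAlbertTypeIII_of_finrank_eq_two hη hG h2)
    · exfalso
      have h2' := hX.finrank_hodgeGroupLie_eq_two_of_isAlbertTypeIV_of_finrank_eq_two hη hG hIV h2
      omega
  · rintro ⟨h4, hnc⟩
    -- `dim End⁰ = 4` and non-commutative: the `(3,4)` line (type II), not the `(2,4)` line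
    have hmem := hX.finrank_hodgeGroupLie_mem_four_of_finrank_eq_two hη h2
    simp only [Finset.mem_insert, Finset.mem_singleton] at hmem
    have hne2 : finrank ℝ (hodgeGroupLie Ψ) ≠ 2 := fun h2' ↦ hnc
      (hX.endAlgRat_comm_and_finrank_eq_four_of_hodgeGroup_comm_of_finrank_eq_two hη h2
        ((hX.finrank_hodgeGroupLie_eq_two_iff_hodgeGroup_comm_of_finrank_eq_two hη h2).1 h2')).1
    have hne6 : finrank ℝ (hodgeGroupLie Ψ) ≠ 6 := fun h6 ↦ by
      have := (hX.finrank_hodgeGroupLie_eq_six_iff_finrank_endAlgRat_eq_two_of_finrank_eq_two hη h2).1 h6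
      omega
    have hne10 : finrank ℝ (hodgeGroupLie Ψ) ≠ 10 := fun h10 ↦ by
      have hbot := (hη.finrank_hodgeGroupLie_eq_ten_iff_endAlgRat_eq_bot_of_finrank_eq_two h2).1 h10
      have : finrank ℚ (endAlgRat Ψ) = 1 := by rw [hbot]; exact Subalgebra.finrank_bot
      omega
    omega

end Simple

end ComplexTorus

end Literature.Geometry.Kaehler
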